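import Summits.NavierStokesRegularity.NavierStokesRegularity.Theses.RellichScar
import Summits.NavierStokesRegularity.NavierStokesRegularity.Theorems.RellichScarSymmetricScarExistsPineauVicolOneSlice
import Summits.NavierStokesRegularity.NavierStokesRegularity.Theorems.RellichScarSymmetricScarExistsGaussianWindowLaw
import Summits.NavierStokesRegularity.NavierStokesRegularity.Theorems.RellichScarSymmetricScarExistsSmallDefectSlice
import Summits.NavierStokesRegularity.NavierStokesRegularity.Theorems.RellichScarSymmetricScarExistsOneSliceCriterion
import Summits.NavierStokesRegularity.NavierStokesRegularity.Theorems.RellichScarSymmetricScarExistsApexLerayProfile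

/-!
# Line `logtime-bernoulli-certificate` for the crux `SymmetricScarExists` (stmt-NavierStokesRegularity-11718)

Lead prover's SKELETON, v2 (after wave 1).  Wave 1 LANDED four of the seven original stubs
(`stub_pineauVicolOneSlice` p71896, `stub_smallDefectSlice` p72305, `stub_oneSliceCriterion` p72457,
`stub_gaussianWindowLaw` p72992+p73327) and REDUCED `stub_apexLerayProfile` to the scale-invariant
regularity of apex profiles (`stub_apexLerayProfile_ofRegularity`,
`apexLerayProfile_of_representative_of_bounds`, p73111+p73412); all under
`Summits/…/Theorems/RellichScarSymmetricScarExists*.lean`, namespace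
`Summit.NavierStokesRegularity.NavierStokesRegularity.Theorems.SymmetricScarExists.LogtimeBernoulli`.

## Reshaped stub set (v2; re-registered with `ledger skeleton check`)

* `stub_apexClassicalRepresentative` (L–XL, KNOWN: KNSS 2009 Lemma 3.1 + Prop. 4.1, A–B 2019 §3):
  an apex suitable weak profile agrees a.e. on the slab with a CLASSICAL solution on `(−∞,0)`.
* `stub_apexScaleInvariantBounds` (L–XL, KNOWN: Seregin–Šverák 2009 §2 at unit scale after the
  Navier–Stokes rescaling + Calderón–Zygmund bounds for the Riesz pressure): a classical Type-I
  solution on the past is classical with SOME pressure obeying the six scale-invariant bounds.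
* `stub_oneGoodSlice` (THE BET in its WEAKEST sufficient form): every eternal backward-Leray profile
  in the weighted class `LB(C,K)` has, for every `δ, R > 0`, ONE slice with self-similar defect
  `‖∂ₛU‖ ≤ δ` on `B_R`.
* `stub_finiteGaussianAction` (stronger bet, the card's transfer target `C⁺`; ⇒ `stub_oneGoodSlice`
  by the landed `stub_smallDefectSlice`) and `stub_logtimeBernoulliCertificate` (the card's
  certificate; ⇒ finite action by the landed window law, `finiteGaussianAction_of_certificate`;
  with an arbitrary slice functional `V` it is EQUIVALENT to a uniform finite action) are kept
  registered as the two stronger entry points of the same bet.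

Composition: `noApexTypeIProfile_of_stubs` (route TARGET) and `symmetricScarExists_proof`
(the crux BY NAME), sorry-free modulo the stubs.

## Honest status of the bet (lead's analysis, cycle 1)

`stub_oneGoodSlice` for the class is EQUIVALENT to "every smooth apex profile has a regular origin"
(= the route target `X` on classical representatives): (⇒) is this file + Pineau–Vicol's one-slice
ε-regularity; (⇐) a regular origin makes `U(s) = √(−t)u → 0` with its `s`-derivative as `s → +∞`;
and in any world containing a time-periodic (λ-DSS) or recurrent non-steady apex Leray profile all
three bet stubs are FALSE (action per period > 0; `inf_s sup_{B_R} ‖∂ₛU‖ > 0` by analyticity +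
backward uniqueness).  No monotonicity formula for the Navier–Stokes zoom flow is known
(Albritton–Barker 2019 §1); the small-constant corner `C < c₀` (ε-regularity / KNSS small Liouville)
is the only unconditional fragment.  So the line is CLOSED MODULO (i) two known-mathematics
regularity stubs and (ii) one X-equivalent bet.
-/

noncomputable section

open MeasureTheory Set Function Filter Topology TopologicalSpace Metric
open scoped NNReal ENNReal

namespace Summit.NavierStokesRegularity.NavierStokesRegularity.Cruxes.SymmetricScarExists.Lines.LogtimeBernoulliCertificate

open Literature.Analysis.FluidPDE
open Summit.NavierStokesRegularity.NavierStokesRegularity.Theses.RellichScar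
open Summit.NavierStokesRegularity.NavierStokesRegularity.Theorems.SymmetricScarExists.LogtimeBernoulli

set_option linter.dupNamespace false

/-! ## Registered stubs (v2) -/

/-- STUB 1a (L–XL, KNOWN mathematics): an apex suitable weak profile has a CLASSICAL REPRESENTATIVE on
`(−∞,0)` — KNSS 2009 Lemma 3.1 (bounded weak = drift-mild + parasitic `b(t)`, tree
`KNSS2009_weak_driftMild_holds`; the decay `‖u‖ ≤ C/‖x‖` kills `b`), Prop. 4.1 / (4.10)–(4.11)
(bounded mild ⇒ smooth, tree `knss2009_smoothing_holds`, `classical_of_smooth_isMildNSSolutionOn_holds`),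
gluing of the windows `t < −δ`; Albritton–Barker 2019 §3.  Hypothesis `hRep` of the landed
`apexLerayProfile_of_representative_of_bounds`, verbatim. -/
theorem stub_apexClassicalRepresentative :
    ∀ (u : ℝ → EuclideanSpace ℝ (Fin 3) → EuclideanSpace ℝ (Fin 3)) (p : ℝ → EuclideanSpace ℝ (Fin 3) → ℝ) (G : ℝ → EuclideanSpace ℝ (Fin 3) → EuclideanSpace ℝ (Fin 3) →L[ℝ] EuclideanSpace ℝ (Fin 3)) (C : ℝ), Literature.Analysis.FluidPDE.IsSuitableWeakSolutionOn (Literature.Analysis.FluidPDE.slab (EuclideanSpace ℝ (Fin 3)) (Set.Iio 0) isOpen_Iio) 1 0 u p → Literature.Analysis.FluidPDE.HasWeakSpatialGradientOn (Literature.Analysis.FluidPDE.slab (EuclideanSpace ℝ (Fin 3)) (Set.Iio 0) isOpen_Iio) u G → Literature.Analysis.FluidPDE.typeIBound (Set.Iio (0 : ℝ) ×ˢ Set.univ) u p G < ⊤ → Literature.Analysis.FluidPDE.HasTypeIDecay C u → ∃ (v : ℝ → EuclideanSpace ℝ (Fin 3) → EuclideanSpace ℝ (Fin 3)) (q : ℝ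 → EuclideanSpace ℝ (Fin 3) → ℝ), Literature.Analysis.FluidPDE.IsClassicalNSSolutionOn (Set.Iio 0) 1 0 v q ∧ Function.uncurry v =ᵐ[MeasureTheory.volume.restrict (Set.Iio (0 : ℝ) ×ˢ (Set.univ : Set (EuclideanSpace ℝ (Fin 3))))] Function.uncurry u := by
  sorry

/-- STUB 1b (L–XL, KNOWN mathematics): SCALE-INVARIANT BOUNDS — a classical solution on `(−∞,0)`
with the Type-I bound `‖v‖ ≤ C/(‖x‖+√(−t))` is classical with SOME pressure (the Riesz pressure
`RᵢRⱼ(vᵢvⱼ)`, tree `PineauVicol2026.gradient_pressure_eq_of_typeI`) obeying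
`(‖x‖+√(−t))^{1+k}‖∇ᵏv‖ ≤ K` (`k = 1,2`), `(·)²|q| ≤ K`, `(·)³‖∇q‖ ≤ K`, `(·)³‖∂ₜv‖ ≤ K`,
`(·)⁴‖∇∂ₜv‖ ≤ K` (Seregin–Šverák 2009 §2 p. 8 with the dependence of the norms — tree
`NSBoundedHigherRegularityBounds_holds` at unit scale after rescaling — plus Calderón–Zygmund for the
pressure).  Hypothesis `hBd` of the landed `apexLerayProfile_of_representative_of_bounds`, verbatim. -/
theorem stub_apexScaleInvariantBounds :
    ∀ (v : ℝ → EuclideanSpace ℝ (Fin 3) → EuclideanSpace ℝ (Fin 3)) (q : ℝ → EuclideanSpace ℝ (Fin 3) → ℝ) (C : ℝ), Literature.Analysis.FluidPDE.IsClassicalNSSolutionOn (Set.Iio 0) 1 0 v q → Literature.Analysis.FluidPDE.HasTypeIDecay C v → ∃ (q' : ℝ → EuclideanSpace ℝ (Fin 3) → ℝ) (K : ℝ), Literature.Analysis.FluidPDE.IsClassicalNSSolutionOn (Set.Iio 0) 1 0 v q' ∧ ∀ t < (0 : ℝ), ∀ (x : EuclideanSpace ℝ (Fin 3)), (‖x‖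 + Real.sqrt (-t)) ^ 2 * ‖fderiv ℝ (v t) x‖ ≤ K ∧ (‖x‖ + Real.sqrt (-t)) ^ 3 * ‖iteratedFDeriv ℝ 2 (v t) x‖ ≤ K ∧ (‖x‖ + Real.sqrt (-t)) ^ 2 * |q' t x| ≤ K ∧ (‖x‖ + Real.sqrt (-t)) ^ 3 * ‖gradient (q' t) x‖ ≤ K ∧ (‖x‖ + Real.sqrt (-t)) ^ 3 * ‖Literature.Analysis.FluidPDE.timeDeriv v t x‖ ≤ K ∧ (‖x‖ + Real.sqrt (-t)) ^ 4 * ‖fderiv ℝ (Literature.Analysis.FluidPDE.timeDeriv v t) x‖ ≤ K := by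
  sorry

/-- STUB 4′ (THE BET, weakest sufficient form; held by the lead): every eternal backward-Leray profile
in the weighted class has, for every `δ, R > 0`, ONE slice `s̄` with `‖∂ₛU(s̄,y)‖ ≤ δ` on `B_R`.
Equivalent (given Pineau–Vicol's ε-regularity, STUB 6) to a regular origin for `ofLerayOrbit U`;
false in any world with a time-periodic non-steady (λ-DSS) apex Leray profile. -/
theorem stub_oneGoodSlice :
    ∀ (C K : ℝ) (U : ℝ → EuclideanSpace ℝ (Fin 3) → EuclideanSpace ℝ (Fin 3)) (P : ℝ → EuclideanSpace ℝ (Fin 3) → ℝ), (Literature.Analysis.FluidPDE.IsBackwardLeraySolutionOn (Set.univ : Set ℝ) 1 U P ∧ ∀ (s : ℝ) (y : EuclideanSpace ℝ (Fin 3)), (1 + ‖y‖) * ‖U s y‖ ≤ C ∧ (1 + ‖y‖) ^ 2 * ‖fderiv ℝ (U s) y‖ ≤ K ∧ (1 + ‖y‖) ^ 3 * ‖iteratedFDeriv ℝ 2 (U s) y‖ ≤ K ∧ (1 + ‖y‖) ^ 2 * |P s y| ≤ K ∧ (1 + ‖y‖) ^ 3 * ‖gradient (P s) y‖ ≤ K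 ∧ (1 + ‖y‖) * ‖Literature.Analysis.FluidPDE.timeDerivWithin (Set.univ : Set ℝ) U s y‖ ≤ K ∧ (1 + ‖y‖) ^ 2 * ‖fderiv ℝ (fun z => Literature.Analysis.FluidPDE.timeDerivWithin (Set.univ : Set ℝ) U s z) y‖ ≤ K ∧ (1 + ‖y‖) ^ 3 * ‖Literature.Analysis.FluidPDE.timeDerivWithin (Set.univ : Set ℝ) U s y + (1 / 2 : ℝ) • U s y + (1 / 2 : ℝ) • fderiv ℝ (U s) y y‖ ≤ K) → ∀ δ : ℝ, 0 < δ → ∀ R : ℝ, 0 < R → (∃ sbar : ℝ, ∀ y : EuclideanSpace ℝ (Fin 3), ‖y‖ < R → ‖Literature.Analysis.FluidPDE.timeDerivWithin (Set.univ : Set ℝ) U sbar y‖ ≤ δ) := by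
  sorry

/-- STUB 4 (stronger bet, the card's transfer target `C⁺`): FINITE GAUSSIAN ACTION
`∫_{s₁}^{s₂}∫‖∂ₛU‖² e^{−|y|²/4} ≤ A`.  Implies STUB 4′ by the landed `stub_smallDefectSlice`
(`oneGoodSlice_of_finiteGaussianAction`). -/
theorem stub_finiteGaussianAction :
    ∀ (C K : ℝ) (U : ℝ → EuclideanSpace ℝ (Fin 3) → EuclideanSpace ℝ (Fin 3)) (P : ℝ → EuclideanSpace ℝ (Fin 3) → ℝ), (Literature.Analysis.FluidPDE.IsBackwardLeraySolutionOn (Set.univ : Set ℝ) 1 U P ∧ ∀ (s : ℝ) (y : EuclideanSpace ℝ (Fin 3)), (1 + ‖y‖) * ‖U s y‖ ≤ C ∧ (1 + ‖y‖) ^ 2 * ‖fderiv ℝ (U s) y‖ ≤ K ∧ (1 + ‖y‖) ^ 3 * ‖iteratedFDeriv ℝ 2 (U s) y‖ ≤ K ∧ (1 + ‖y‖) ^ 2 * |P s y| ≤ K ∧ (1 + ‖y‖) ^ 3 * ‖gradient (P s) y‖ ≤ K ∧ (1 + ‖y‖) * ‖Literature.Analysis.FluidPDE.timeDerivWithin (Set.univ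 : Set ℝ) U s y‖ ≤ K ∧ (1 + ‖y‖) ^ 2 * ‖fderiv ℝ (fun z => Literature.Analysis.FluidPDE.timeDerivWithin (Set.univ : Set ℝ) U s z) y‖ ≤ K ∧ (1 + ‖y‖) ^ 3 * ‖Literature.Analysis.FluidPDE.timeDerivWithin (Set.univ : Set ℝ) U s y + (1 / 2 : ℝ) • U s y + (1 / 2 : ℝ) • fderiv ℝ (U s) y y‖ ≤ K) → (∃ A : ℝ, ∀ s₁ s₂ : ℝ, s₁ ≤ s₂ → (∫ σ in s₁..s₂, (∫ y : EuclideanSpace ℝ (Fin 3), ‖Literature.Analysis.FluidPDE.timeDerivWithin (Set.univ : Set ℝ) U σ y‖ ^ 2 * Literature.Analysis.FluidPDE.PineauVicol2026.gaussWeight y)) ≤ A) := by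
  sorry

/-- STUB 3 (strongest bet, the card's LOG-TIME LYAPUNOV CERTIFICATE): a bounded slice functional
`V` whose drop dominates the Gaussian action.  With an arbitrary `V` this is equivalent to a UNIFORM
finite Gaussian action (define `V` as `−c ×` the action accumulated along the unique trajectory
through the slice); implies STUB 4 by the landed window law (`finiteGaussianAction_of_certificate`). -/
theorem stub_logtimeBernoulliCertificate :
    ∀ (C K : ℝ), ∃ (V : (EuclideanSpace ℝ (Fin 3) → EuclideanSpace ℝ (Fin 3)) → (EuclideanSpace ℝ (Fin 3) → ℝ) → ℝ) (c B : ℝ), 0 < c ∧ ∀ (U : ℝ → EuclideanSpace ℝ (Fin 3) → EuclideanSpace ℝ (Fin 3)) (P : ℝ → EuclideanSpace ℝ (Fin 3) → ℝ), (Literature.Analysis.FluidPDE.IsBackwardLeraySolutionOn (Set.univ : Set ℝ) 1 U P ∧ ∀ (s : ℝ) (y : EuclideanSpace ℝ (Fin 3)), (1 + ‖y‖) * ‖U s y‖ ≤ C ∧ (1 + ‖y‖) ^ 2 * ‖fderiv ℝ (U s) y‖ ≤ K ∧ (1 + ‖y‖) ^ 3 * ‖iteratedFDeriv ℝ 2 (U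 s) y‖ ≤ K ∧ (1 + ‖y‖) ^ 2 * |P s y| ≤ K ∧ (1 + ‖y‖) ^ 3 * ‖gradient (P s) y‖ ≤ K ∧ (1 + ‖y‖) * ‖Literature.Analysis.FluidPDE.timeDerivWithin (Set.univ : Set ℝ) U s y‖ ≤ K ∧ (1 + ‖y‖) ^ 2 * ‖fderiv ℝ (fun z => Literature.Analysis.FluidPDE.timeDerivWithin (Set.univ : Set ℝ) U s z) y‖ ≤ K ∧ (1 + ‖y‖) ^ 3 * ‖Literature.Analysis.FluidPDE.timeDerivWithin (Set.univ : Set ℝ) U s y + (1 / 2 : ℝ) • U s y + (1 / 2 : ℝ) • fderiv ℝ (U s) y y‖ ≤ K) → ((∀ s : ℝ, (∫ y : EuclideanSpace ℝ (Fin 3), ‖U s y‖ ^ 2 * Literature.Analysis.FluidPDE.PineauVicol2026.gaussWeight y) ≤ C ^ 2 * (∫ y : EuclideanSpace ℝ (Fin 3), Literature.Analysis.FluidPDE.PineauVicol2026.gaussWeight y)) ∧ ∀ s₁ s₂ : ℝ, s₁ ≤ s₂ → (1 / 2 : ℝ) * (∫ y : EuclideanSpace ℝ (Fin 3), ‖U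 s₂ y‖ ^ 2 * Literature.Analysis.FluidPDE.PineauVicol2026.gaussWeight y) - (1 / 2 : ℝ) * (∫ y : EuclideanSpace ℝ (Fin 3), ‖U s₁ y‖ ^ 2 * Literature.Analysis.FluidPDE.PineauVicol2026.gaussWeight y) = -(∫ σ in s₁..s₂, ((∫ y : EuclideanSpace ℝ (Fin 3), Literature.Analysis.FluidPDE.frobeniusNormSq (fderiv ℝ (U σ) y) * Literature.Analysis.FluidPDE.PineauVicol2026.gaussWeight y) + (1 / 2 : ℝ) * (∫ y : EuclideanSpace ℝ (Fin 3), ‖U σ y‖ ^ 2 * Literature.Analysis.FluidPDE.PineauVicol2026.gaussWeight y) + (1 / 2 : ℝ) * (∫ y : EuclideanSpace ℝ (Fin 3), (P σ y + (1 / 2 : ℝ) * ‖U σ y‖ ^ 2) * inner ℝ y (U σ y) * Literature.Analysis.FluidPDE.PineauVicol2026.gaussWeight y)))) → (∀ s : ℝ, |V (U s) (P s)| ≤ B) ∧ ∀ s₁ s₂ : ℝ, s₁ ≤ s₂ → c * (∫ σ in s₁..s₂, (∫ y : EuclideanSpace ℝ (Fin 3), ‖Literature.Analysis.FluidPDE.timeDerivWithin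 (Set.univ : Set ℝ) U σ y‖ ^ 2 * Literature.Analysis.FluidPDE.PineauVicol2026.gaussWeight y)) ≤ V (U s₁) (P s₁) - V (U s₂) (P s₂) := by
  sorry

/-! ## Composition (sorry-free modulo the stubs) -/

/-- STUB 1 of the original skeleton, now DERIVED: apex profile ⇒ smooth eternal backward-Leray profile
with the eight weighted bounds, a.e. equal, origin still singular (landed reduction
`apexLerayProfile_of_representative_of_bounds` + STUBS 1a, 1b). -/
theorem apexLerayProfile :
    ∀ (u : ℝ → EuclideanSpace ℝ (Fin 3) → EuclideanSpace ℝ (Fin 3)) (p : ℝ → EuclideanSpace ℝ (Fin 3) → ℝ) (G : ℝ → EuclideanSpace ℝ (Fin 3) → EuclideanSpace ℝ (Fin 3) →L[ℝ] EuclideanSpace ℝ (Fin 3)) (C : ℝ), Literature.Analysis.FluidPDE.IsSuitableWeakSolutionOn (Literature.Analysis.FluidPDE.slab (EuclideanSpace ℝ (Fin 3)) (Set.Iio 0) isOpen_Iio) 1 0 u p → Literature.Analysis.FluidPDE.HasWeakSpatialGradientOn (Literature.Analysis.FluidPDE.slab (EuclideanSpace ℝ (Fin 3)) (Set.Iio 0)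 isOpen_Iio) u G → Literature.Analysis.FluidPDE.typeIBound (Set.Iio (0 : ℝ) ×ˢ Set.univ) u p G < ⊤ → Literature.Analysis.FluidPDE.HasTypeIDecay C u → Literature.Analysis.FluidPDE.IsBackwardSingularPoint u 0 → ∃ (U : ℝ → EuclideanSpace ℝ (Fin 3) → EuclideanSpace ℝ (Fin 3)) (P : ℝ → EuclideanSpace ℝ (Fin 3) → ℝ) (K : ℝ), (Literature.Analysis.FluidPDE.IsBackwardLeraySolutionOn (Set.univ : Set ℝ) 1 U P ∧ ∀ (s : ℝ) (y : EuclideanSpace ℝ (Fin 3)), (1 + ‖y‖) * ‖U s y‖ ≤ C ∧ (1 + ‖y‖) ^ 2 * ‖fderiv ℝ (U s) y‖ ≤ K ∧ (1 + ‖y‖) ^ 3 * ‖iteratedFDeriv ℝ 2 (U s) y‖ ≤ K ∧ (1 + ‖y‖) ^ 2 * |P s y| ≤ K ∧ (1 + ‖y‖) ^ 3 * ‖gradient (P s) y‖ ≤ K ∧ (1 + ‖y‖) * ‖Literature.Analysis.FluidPDE.timeDerivWithin (Set.univ : Set ℝ) U s y‖ ≤ K ∧ (1 + ‖y‖) ^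 2 * ‖fderiv ℝ (fun z => Literature.Analysis.FluidPDE.timeDerivWithin (Set.univ : Set ℝ) U s z) y‖ ≤ K ∧ (1 + ‖y‖) ^ 3 * ‖Literature.Analysis.FluidPDE.timeDerivWithin (Set.univ : Set ℝ) U s y + (1 / 2 : ℝ) • U s y + (1 / 2 : ℝ) • fderiv ℝ (U s) y y‖ ≤ K) ∧ (Function.uncurry (Literature.Analysis.FluidPDE.ofLerayOrbit U) =ᵐ[MeasureTheory.volume.restrict (Set.Iio (0 : ℝ) ×ˢ (Set.univ : Set (EuclideanSpace ℝ (Fin 3))))] Function.uncurry u) ∧ Literature.Analysis.FluidPDE.IsBackwardSingularPoint (Literature.Analysis.FluidPDE.ofLerayOrbit U) 0 :=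
  apexLerayProfile_of_representative_of_bounds stub_apexClassicalRepresentative
    stub_apexScaleInvariantBounds

/-- STUB 4 ⇒ STUB 4′ (landed `stub_smallDefectSlice`). [folklore] -/
theorem oneGoodSlice_of_finiteGaussianAction :
    ∀ (C K : ℝ) (U : ℝ → EuclideanSpace ℝ (Fin 3) → EuclideanSpace ℝ (Fin 3)) (P : ℝ → EuclideanSpace ℝ (Fin 3) → ℝ), (Literature.Analysis.FluidPDE.IsBackwardLeraySolutionOn (Set.univ : Set ℝ) 1 U P ∧ ∀ (s : ℝ) (y : EuclideanSpace ℝ (Fin 3)), (1 + ‖y‖) * ‖U s y‖ ≤ C ∧ (1 + ‖y‖) ^ 2 * ‖fderiv ℝ (U s) y‖ ≤ K ∧ (1 + ‖y‖) ^ 3 * ‖iteratedFDeriv ℝ 2 (U s) y‖ ≤ K ∧ (1 + ‖y‖) ^ 2 * |P s y| ≤ K ∧ (1 + ‖y‖) ^ 3 * ‖gradient (P s) y‖ ≤ K ∧ (1 + ‖y‖) * ‖Literature.Analysis.FluidPDE.timeDerivWithin (Set.univ : Set ℝ) U s y‖ ≤ K ∧ (1 + ‖y‖) ^ 2 * ‖fderiv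 ℝ (fun z => Literature.Analysis.FluidPDE.timeDerivWithin (Set.univ : Set ℝ) U s z) y‖ ≤ K ∧ (1 + ‖y‖) ^ 3 * ‖Literature.Analysis.FluidPDE.timeDerivWithin (Set.univ : Set ℝ) U s y + (1 / 2 : ℝ) • U s y + (1 / 2 : ℝ) • fderiv ℝ (U s) y y‖ ≤ K) → ∀ δ : ℝ, 0 < δ → ∀ R : ℝ, 0 < R → (∃ sbar : ℝ, ∀ y : EuclideanSpace ℝ (Fin 3), ‖y‖ < R → ‖Literature.Analysis.FluidPDE.timeDerivWithin (Set.univ : Set ℝ) U sbar y‖ ≤ δ) := fun C K U P hLB δ hδ R hR =>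
  stub_smallDefectSlice C K U P hLB (stub_finiteGaussianAction C K U P hLB) δ hδ R hR

/-- STUBS 2 (landed) + 3 ⇒ STUB 4's conclusion: `c·Act(s₁,s₂) ≤ V(s₁) − V(s₂) ≤ 2B`. [folklore] -/
theorem finiteGaussianAction_of_certificate :
    ∀ (C K : ℝ) (U : ℝ → EuclideanSpace ℝ (Fin 3) → EuclideanSpace ℝ (Fin 3)) (P : ℝ → EuclideanSpace ℝ (Fin 3) → ℝ), (Literature.Analysis.FluidPDE.IsBackwardLeraySolutionOn (Set.univ : Set ℝ) 1 U P ∧ ∀ (s : ℝ) (y : EuclideanSpace ℝ (Fin 3)), (1 + ‖y‖) * ‖U s y‖ ≤ C ∧ (1 + ‖y‖) ^ 2 * ‖fderiv ℝ (U s) y‖ ≤ K ∧ (1 + ‖y‖) ^ 3 * ‖iteratedFDeriv ℝ 2 (U s) y‖ ≤ K ∧ (1 + ‖y‖) ^ 2 * |P s y| ≤ K ∧ (1 + ‖y‖) ^ 3 * ‖gradient (P s) y‖ ≤ K ∧ (1 + ‖y‖) * ‖Literature.Analysis.FluidPDE.timeDerivWithin (Set.univ : Set ℝ) U s y‖ ≤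 K ∧ (1 + ‖y‖) ^ 2 * ‖fderiv ℝ (fun z => Literature.Analysis.FluidPDE.timeDerivWithin (Set.univ : Set ℝ) U s z) y‖ ≤ K ∧ (1 + ‖y‖) ^ 3 * ‖Literature.Analysis.FluidPDE.timeDerivWithin (Set.univ : Set ℝ) U s y + (1 / 2 : ℝ) • U s y + (1 / 2 : ℝ) • fderiv ℝ (U s) y y‖ ≤ K) → (∃ A : ℝ, ∀ s₁ s₂ : ℝ, s₁ ≤ s₂ → (∫ σ in s₁..s₂, (∫ y : EuclideanSpace ℝ (Fin 3), ‖Literature.Analysis.FluidPDE.timeDerivWithin (Set.univ : Set ℝ) U σ y‖ ^ 2 * Literature.Analysis.FluidPDE.PineauVicol2026.gaussWeight y)) ≤ A) := by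
  intro C K U P hLB
  obtain ⟨V, c, B, hc, hcert⟩ := stub_logtimeBernoulliCertificate C K
  obtain ⟨hV, hdrop⟩ := hcert U P hLB (stub_gaussianWindowLaw C K U P hLB)
  refine ⟨2 * B / c, fun s₁ s₂ hs => ?_⟩
  have h1 := hdrop s₁ s₂ hs
  have h2 : V (U s₁) (P s₁) - V (U s₂) (P s₂) ≤ 2 * B := by
    have ha := hV s₁
    have hb := hV s₂
    rw [abs_le] at ha hb
    linarith
  rw [le_div_iff₀ hc]
  linarith

/-- **The stubs prove the route TARGET `NoApexTypeIProfile`**: smooth Leray representative (1a+1b)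
⇒ one good slice (4′) ⇒ regular origin by Pineau–Vicol's one-slice theorem (landed STUBS 6, 7) —
contradicting the singularity of the representative. -/
theorem noApexTypeIProfile_of_stubs : NoApexTypeIProfile := by
  intro u p G C hsw hwg hI hdec hsing
  obtain ⟨U, P, K, hLB, -, hsingU⟩ := apexLerayProfile u p G C hsw hwg hI hdec hsing
  obtain ⟨δ, hδ, hcrit⟩ := stub_oneSliceCriterion stub_pineauVicolOneSlice C
  obtain ⟨R, hR, hreg⟩ := hcrit K
  obtain ⟨sbar, hsbar⟩ := stub_oneGoodSlice C K U P hLB δ hδ R hR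
  exact hreg U P hLB ⟨sbar, hsbar⟩ hsingU

/-- From the target to the crux: with no singular apex profile the antecedent of
`SymmetricScarExists` is empty. [folklore] -/
theorem symmetricScarExists_of_noApexTypeIProfile (hX : NoApexTypeIProfile) : SymmetricScarExists := by
  intro C hex
  obtain ⟨u, p, G, hsw, hwg, hI, hdec, hsing⟩ := hex
  exact absurd hsing (hX u p G C hsw hwg hI hdec)

/-- **The line closes the crux modulo its stubs**: `SymmetricScarExists` BY NAME. -/
theorem symmetricScarExists_proof : SymmetricScarExists :=
  symmetricScarExists_of_noApexTypeIProfile noApexTypeIProfile_of_stubs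

end Summit.NavierStokesRegularity.NavierStokesRegularity.Cruxes.SymmetricScarExists.Lines.LogtimeBernoulliCertificate

end
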